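import Literature.Analysis.SegalBargmann.FockHermite
import Literature.Analysis.FunctionSpaces.GaussianSchwartz
import HarnessLib

/-!
# The Hermite span as smooth and Schwartz functions; its stability under linear vector fields
(Folland 1989, §1.7 and Theorem (4.45))

Topic `Analysis/SegalBargmann`; namespace `Literature.Analysis.SegalBargmann`. Continuation of
`Literature.Analysis.SegalBargmann.FockHermite`, whose genuine functions `hermiteFun p x = p(x) e^{−π|x|²}` on
`ℝ^σ` (`σ` a finite index type) with polynomial SYMBOL `p ∈ ℂ[x_σ]` carry Folland's operators as
endomorphisms of the symbol space (`opDel j p = ∂_j p − 2π x_j p` is the symbol of `∂/∂x_j`,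
`FockHermite.hasDerivAt_hermiteFun`). This file adds the multivariable calculus and the Schwartz-space
packaging that the `L²`/representation theory on top of the Hermite span needs:

* §1 `contDiff_hermiteFun` — `p e^{−π|x|²}` is `C^∞` on `σ → ℝ` (hence `differentiable_hermiteFun`).
* §2 `fderiv_hermiteFun_single`, `fderiv_hermiteFun_apply` — the Fréchet derivative in a direction `v` has
  symbol `dirSymb v p = Σ_j v_j · opDel j p`; `hermiteFunₗ` (linearity of `p ↦ hermiteFun p` packaged).
* §3 LINEAR VECTOR FIELDS: for an `ℝ`-linear `A : (σ → ℝ) →ₗ[ℝ] (σ → ℝ)` the derivative of `hermiteFun p` at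
  `x` in the direction `A x` is again in the Hermite span, with symbol
  `linSymb A p = Σ_{j,k} A_{jk} · x_k · opDel j p` (`fderiv_hermiteFun_linear`), and along any curve `γ` through
  `x` with velocity `A x` one has `d/ds|₀ hermiteFun p (γ s) = hermiteFun (linSymb A p) x`
  (`hasDerivAt_hermiteFun_comp_of_hasDerivAt`). This is the Hermite-span instance of the first displayed formula
  in the proof of Folland's Theorem (4.45) — "`d/dt [f(e^{−t A} x)]_{t=0} = − Σ A_{jk} x_k ∂f/∂x_j (x)`" for
  `f ∈ 𝒮` (the Levi factor `diag(A, −Aᵀ) ∈ 𝔰𝔭` of the metaplectic representation acting by `f ↦ f ∘ e^{−tA}` up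
  to `det^{−1/2}`) — with the extra information that the Hermite span is STABLE under these generators and
  with the symbol computed (Folland (4.49): finite linear combinations of Hermite functions are analytic, in
  particular smooth, vectors for the quadratic operators).
* §4 SCHWARTZ PACKAGING on `E = EuclideanSpace ℝ σ`: `polyE p` (temperate growth, `hasTemperateGrowth_polyE`),
  `hermiteSchwartz p : 𝓢(E, ℂ) := smulLeftCLM (polyE p) (gaussianSchwartz E π)` with
  `hermiteSchwartz_apply : hermiteSchwartz p x = hermiteFun p ⇑x` (`gauss_eq_gaussianSchwartz`: the Gaussian of
  `FockHermite` IS the tree's `Literature.Analysis.FunctionSpaces.gaussianSchwartz E π`), linear and injective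
  in `p` (`hermiteSchwartzₗ`, `hermiteSchwartz_injective`) — Folland §1.7: the Hermite functions lie in
  `𝒮(ℝⁿ)` — and the transported derivative formulas `fderiv_hermiteSchwartz_linear`,
  `hasDerivAt_hermiteSchwartz_comp_of_hasDerivAt` for a continuous linear vector field `A : E →L[ℝ] E`
  (symbol `linSymb` of the matrix of `A` in the standard coordinates, `toCoords A`).

Everything is proved from Mathlib and the two imported tree files; no cited fact is used as a hypothesis.
Mathlib has `SchwartzMap.smulLeftCLM`, `Function.HasTemperateGrowth`, `hasDerivAt_update`, but no Hermite
functions in several variables (`lean search 'hermiteSchwartz|contDiff_hermiteFun|fderiv_hermiteFun'`: only the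
one-variable kinetic-theory ladder `Literature.MathematicalPhysics.KineticTheory.MomentumHermiteLadder`).

## References

* G. B. Folland, *Harmonic Analysis in Phase Space*, Annals of Mathematics Studies 122, Princeton UP (1989):
  §1.7 (Hermite functions `h_α = H_α e^{−πx²}`), Theorem (4.45) and its proof (the Schwartz space consists of
  `C^∞` vectors for the metaplectic representation; `d/dt f(e^{−tA}x)|₀ = −Σ A_{jk} x_k ∂_j f`), Proposition
  (4.49) (Hermite functions are analytic vectors). [cite: Folland1989, Thm 4.45]

## Provenance

Written for the tree under the LEAN-IN-TREE rule (2026-08-18) by the pub-hodgecm formalisation cell (DAG-node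
prover #06 lineage, seat pv06-g8), generalising the cell's staging files `HodgeCM/PerL34/ArchCHyperbolicFDeriv.lean`
§1/§3 and `HodgeCM/PerL34/ArchCHyperbolicSchwartz.lean` §1/§3 (seat pv06-g7, gate run 31) from the one
hyperbolic vector field on `ℝ³ × ℝ³` used there to an arbitrary linear vector field on `ℝ^σ`, over the tree's
`FockHermite` (instead of the cell's `Fock.Hermite`) and the tree's `gaussianSchwartz` (instead of the cell's
`SchwartzWeil.gaussian`).
-/

set_option autoImplicit false

noncomputable section

open MvPolynomial Complex
open scoped BigOperators Real

namespace Literature.Analysis.SegalBargmann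

variable {σ : Type*} [Fintype σ] [DecidableEq σ]

/-! ## §1  Smoothness of the Hermite-span functions -/

section Smooth

omit [DecidableEq σ] in
/-- A real coordinate, cast to `ℂ`, is a `C^∞` function on `σ → ℝ`. [folklore] -/
theorem contDiff_coord_ofReal (k : σ) {n : WithTop ℕ∞} :
    ContDiff ℝ n (fun x : σ → ℝ => ((x k : ℝ) : ℂ)) :=
  Complex.ofRealCLM.contDiff.comp (contDiff_apply ℝ ℝ k)

omit [DecidableEq σ] in
/-- Polynomial functions of the real coordinates are `C^∞` (induction on the polynomial). [folklore] -/
theorem contDiff_eval_ofReal (p : MvPolynomial σ ℂ) {n : WithTop ℕ∞} :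
    ContDiff ℝ n (fun x : σ → ℝ => eval (fun k => ((x k : ℝ) : ℂ)) p) := by
  induction p using MvPolynomial.induction_on with
  | C a =>
      simp only [eval_C]
      exact contDiff_const
  | add p q hp hq =>
      simp only [map_add]
      exact hp.add hq
  | mul_X p k hp =>
      simp only [map_mul, eval_X]
      exact hp.mul (contDiff_coord_ofReal k)

omit [DecidableEq σ] in
/-- The Gaussian `x ↦ e^{−π Σ x_k²}` is `C^∞`. [folklore] -/
theorem contDiff_gauss {n : WithTop ℕ∞} : ContDiff ℝ n (gauss : (σ → ℝ) → ℂ) := by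
  unfold gauss
  exact (contDiff_const.mul (ContDiff.sum fun k _ => (contDiff_coord_ofReal k).pow 2)).cexp

omit [DecidableEq σ] in
/-- **`p e^{−π|·|²}` is `C^∞` on `σ → ℝ`.** [folklore] -/
theorem contDiff_hermiteFun (p : MvPolynomial σ ℂ) {n : WithTop ℕ∞} :
    ContDiff ℝ n (hermiteFun p : (σ → ℝ) → ℂ) :=
  (contDiff_eval_ofReal p).mul contDiff_gauss

omit [DecidableEq σ] in
/-- `p e^{−π|·|²}` is (Fréchet-)differentiable on `σ → ℝ`. [folklore] -/
theorem differentiable_hermiteFun (p : MvPolynomial σ ℂ) :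
    Differentiable ℝ (hermiteFun p : (σ → ℝ) → ℂ) :=
  (contDiff_hermiteFun p (n := 1)).differentiable one_ne_zero

end Smooth

/-! ## §2  Directional derivatives and their symbols -/

section Directional

omit [DecidableEq σ] in
/-- `p ↦ hermiteFun p` as a `ℂ`-linear map into functions. [folklore] -/
def hermiteFunₗ : MvPolynomial σ ℂ →ₗ[ℂ] ((σ → ℝ) → ℂ) where
  toFun := hermiteFun
  map_add' p q := funext (hermiteFun_add p q)
  map_smul' c p := funext (hermiteFun_smul c p)

omit [DecidableEq σ] in
/-- `hermiteFunₗ p = hermiteFun p`. [folklore] -/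
@[simp] theorem hermiteFunₗ_apply (p : MvPolynomial σ ℂ) : hermiteFunₗ p = hermiteFun p := rfl

omit [DecidableEq σ] in
/-- `hermiteFun` is additive over finite sums of symbols. [folklore] -/
theorem hermiteFun_sum {ι : Type*} (s : Finset ι) (q : ι → MvPolynomial σ ℂ) (x : σ → ℝ) :
    hermiteFun (∑ i ∈ s, q i) x = ∑ i ∈ s, hermiteFun (q i) x := by
  rw [← hermiteFunₗ_apply, map_sum, Finset.sum_apply]
  rfl

/-- **The partial derivative `∂/∂x_j` as a Fréchet derivative**: `D(p e^{−π|·|²})(x)(e_j)` has symbol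
`opDel j p = ∂_j p − 2π x_j p` (from `FockHermite.hasDerivAt_hermiteFun` by uniqueness of derivatives along
`t ↦ update x j t`). [folklore] -/
theorem fderiv_hermiteFun_single (p : MvPolynomial σ ℂ) (x : σ → ℝ) (j : σ) :
    fderiv ℝ (hermiteFun p) x (Pi.single j 1) = hermiteFun (opDel j p) x := by
  have h1 : HasDerivAt (fun t : ℝ => hermiteFun p (Function.update x j t))
      (fderiv ℝ (hermiteFun p) (Function.update x j (x j)) (Pi.single j 1)) (x j) :=
    ((differentiable_hermiteFun p) _).hasFDerivAt.comp_hasDerivAt (x j) (hasDerivAt_update x j (x j))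
  rw [Function.update_eq_self] at h1
  exact h1.unique (hasDerivAt_hermiteFun p x j)

/-- The symbol of the directional derivative in the direction `v`: `Σ_j v_j · (∂_j p − 2π x_j p)`. [folklore] -/
def dirSymb (v : σ → ℝ) (p : MvPolynomial σ ℂ) : MvPolynomial σ ℂ := ∑ j, ((v j : ℝ) : ℂ) • opDel j p

/-- **Directional derivatives stay in the Hermite span**: `D(p e^{−π|·|²})(x)(v) = (dirSymb v p) e^{−π|·|²} (x)`.
[folklore] -/
theorem fderiv_hermiteFun_apply (p : MvPolynomial σ ℂ) (x v : σ → ℝ) :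
    fderiv ℝ (hermiteFun p) x v = hermiteFun (dirSymb v p) x := by
  conv_lhs => rw [pi_eq_sum_univ' v]
  rw [map_sum, dirSymb, hermiteFun_sum]
  refine Finset.sum_congr rfl fun j _ => ?_
  rw [map_smul, fderiv_hermiteFun_single, hermiteFun_smul, Complex.real_smul]

end Directional

/-! ## §3  Linear vector fields: the Levi generators on the Hermite span -/

section Linear

/-- The symbol of the derivative along the linear vector field `x ↦ A x`:
`linSymb A p = Σ_{j,k} A_{jk} · x_k · (∂_j p − 2π x_j p)`, `A_{jk} = (A e_k)_j`. [folklore] -/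
def linSymb (A : (σ → ℝ) →ₗ[ℝ] (σ → ℝ)) (p : MvPolynomial σ ℂ) : MvPolynomial σ ℂ :=
  ∑ j, ∑ k, ((A (Pi.single k 1) j : ℝ) : ℂ) • (X k * opDel j p)

/-- `linSymb A` is `ℂ`-linear in the symbol. [folklore] -/
theorem linSymb_add (A : (σ → ℝ) →ₗ[ℝ] (σ → ℝ)) (p q : MvPolynomial σ ℂ) :
    linSymb A (p + q) = linSymb A p + linSymb A q := by
  simp only [linSymb, map_add, mul_add, smul_add, Finset.sum_add_distrib]

/-- `linSymb A (c • p) = c • linSymb A p`. [folklore] -/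
theorem linSymb_smul (A : (σ → ℝ) →ₗ[ℝ] (σ → ℝ)) (c : ℂ) (p : MvPolynomial σ ℂ) :
    linSymb A (c • p) = c • linSymb A p := by
  simp only [linSymb, map_smul, mul_smul_comm, smul_comm _ c, Finset.smul_sum]

/-- The coordinates of `A x` in terms of the matrix entries `(A e_k)_j`. [folklore] -/
theorem linearMap_apply_eq_sum (A : (σ → ℝ) →ₗ[ℝ] (σ → ℝ)) (x : σ → ℝ) (j : σ) :
    A x j = ∑ k, x k * A (Pi.single k 1) j := by
  conv_lhs => rw [pi_eq_sum_univ' x, map_sum]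
  rw [Finset.sum_apply]
  refine Finset.sum_congr rfl fun k _ => ?_
  rw [map_smul, Pi.smul_apply, smul_eq_mul]

/-- **The Hermite span is stable under linear vector fields, with symbol `linSymb`**:
`D(p e^{−π|·|²})(x)(A x) = (linSymb A p) e^{−π|·|²} (x)` — the Hermite-span case of
"`d/dt f(e^{tA} x)|₀ = Σ A_{jk} x_k ∂_j f (x)`" (Folland 1989, proof of Thm (4.45), Levi part). [folklore] -/
theorem fderiv_hermiteFun_linear (p : MvPolynomial σ ℂ) (A : (σ → ℝ) →ₗ[ℝ] (σ → ℝ)) (x : σ → ℝ) :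
    fderiv ℝ (hermiteFun p) x (A x) = hermiteFun (linSymb A p) x := by
  rw [fderiv_hermiteFun_apply, dirSymb, linSymb, hermiteFun_sum, hermiteFun_sum]
  refine Finset.sum_congr rfl fun j _ => ?_
  rw [hermiteFun_smul, hermiteFun_sum, linearMap_apply_eq_sum, Complex.ofReal_sum, Finset.sum_mul]
  refine Finset.sum_congr rfl fun k _ => ?_
  rw [hermiteFun_smul, hermiteFun_X_mul]
  push_cast
  ring

omit [DecidableEq σ] in
/-- **Chain rule along a curve**: if `γ` passes through `x` at `s₀` with velocity `w`, then
`d/ds|_{s₀} (p e^{−π|·|²})(γ s) = D(p e^{−π|·|²})(x)(w)`. [folklore] -/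
theorem hasDerivAt_hermiteFun_comp (p : MvPolynomial σ ℂ) {γ : ℝ → σ → ℝ} {w x : σ → ℝ} {s₀ : ℝ}
    (hγ : HasDerivAt γ w s₀) (hx : γ s₀ = x) :
    HasDerivAt (fun s => hermiteFun p (γ s)) (fderiv ℝ (hermiteFun p) x w) s₀ := by
  subst hx
  exact ((differentiable_hermiteFun p) _).hasFDerivAt.comp_hasDerivAt s₀ hγ

/-- **Along a curve with linear velocity field** (e.g. the flow `s ↦ e^{sA} x`): if `γ s₀ = x` and
`γ' (s₀) = A x`, then `d/ds|_{s₀} (p e^{−π|·|²})(γ s) = (linSymb A p) e^{−π|·|²} (x)`. [folklore] -/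
theorem hasDerivAt_hermiteFun_comp_of_hasDerivAt (p : MvPolynomial σ ℂ) (A : (σ → ℝ) →ₗ[ℝ] (σ → ℝ))
    {γ : ℝ → σ → ℝ} {x : σ → ℝ} {s₀ : ℝ} (hγ : HasDerivAt γ (A x) s₀) (hx : γ s₀ = x) :
    HasDerivAt (fun s => hermiteFun p (γ s)) (hermiteFun (linSymb A p) x) s₀ := by
  rw [← fderiv_hermiteFun_linear]
  exact hasDerivAt_hermiteFun_comp p hγ hx

end Linear

/-! ## §4  The Hermite span inside the Schwartz space of `EuclideanSpace ℝ σ` -/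

section Schwartz

open SchwartzMap Literature.Analysis.FunctionSpaces

/-- The polynomial factor `x ↦ p(x)` on Euclidean space. [folklore] -/
def polyE (p : MvPolynomial σ ℂ) (x : EuclideanSpace ℝ σ) : ℂ := eval (fun k => ((x k : ℝ) : ℂ)) p

omit [Fintype σ] [DecidableEq σ] in
/-- `polyE p x = p(x)`. [folklore] -/
theorem polyE_apply (p : MvPolynomial σ ℂ) (x : EuclideanSpace ℝ σ) :
    polyE p x = eval (fun k => ((x k : ℝ) : ℂ)) p := rfl

omit [DecidableEq σ] in
/-- A real coordinate of Euclidean space, cast to `ℂ`, is a continuous linear map, hence of temperate growth.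
[folklore] -/
theorem hasTemperateGrowth_coordE (k : σ) :
    (fun x : EuclideanSpace ℝ σ => ((x k : ℝ) : ℂ)).HasTemperateGrowth :=
  (Complex.ofRealCLM.comp (EuclideanSpace.proj k : EuclideanSpace ℝ σ →L[ℝ] ℝ)).hasTemperateGrowth

omit [DecidableEq σ] in
/-- Polynomials have temperate growth on Euclidean space (induction on the polynomial; Mathlib's
`Function.HasTemperateGrowth.add/.mul`). [folklore] -/
theorem hasTemperateGrowth_polyE (p : MvPolynomial σ ℂ) : (polyE p).HasTemperateGrowth := by
  induction p using MvPolynomial.induction_on with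
  | C a =>
      have h : (polyE (C a : MvPolynomial σ ℂ)) = fun _ => a := by
        funext x; simp [polyE]
      rw [h]; exact Function.HasTemperateGrowth.const a
  | add p q hp hq =>
      have h : polyE (p + q) = polyE p + polyE q := by
        funext x; simp [polyE]
      rw [h]; exact hp.add hq
  | mul_X p k hp =>
      have h : polyE (p * X k) = polyE p * fun x : EuclideanSpace ℝ σ => ((x k : ℝ) : ℂ) := by
        funext x; simp [polyE]
      rw [h]; exact hp.mul (hasTemperateGrowth_coordE k)

omit [DecidableEq σ] in
/-- The Gaussian `gauss` of `FockHermite`, evaluated at the coordinates of `x`, IS the tree's Schwartz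
Gaussian `gaussianSchwartz E π` on `E = EuclideanSpace ℝ σ`. [folklore] -/
theorem gauss_eq_gaussianSchwartz (x : EuclideanSpace ℝ σ) :
    gauss (⇑x : σ → ℝ) = gaussianSchwartz (EuclideanSpace ℝ σ) π x := by
  rw [gaussianSchwartz_apply Real.pi_pos, gauss, Complex.ofReal_exp]
  congr 1
  rw [EuclideanSpace.real_norm_sq_eq]
  push_cast
  ring

/-- **`p e^{−π|·|²}` as a Schwartz function** on `EuclideanSpace ℝ σ` (Folland 1989, §1.7: the Hermite
functions lie in `𝒮(ℝⁿ)`). [folklore] -/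
def hermiteSchwartz (p : MvPolynomial σ ℂ) : 𝓢(EuclideanSpace ℝ σ, ℂ) :=
  SchwartzMap.smulLeftCLM ℂ (polyE p) (gaussianSchwartz (EuclideanSpace ℝ σ) π)

omit [DecidableEq σ] in
/-- Its values: `hermiteSchwartz p x = hermiteFun p x` (the `FockHermite` function at the coordinates of `x`).
[folklore] -/
theorem hermiteSchwartz_apply (p : MvPolynomial σ ℂ) (x : EuclideanSpace ℝ σ) :
    hermiteSchwartz p x = hermiteFun p (⇑x : σ → ℝ) := by
  rw [hermiteSchwartz, SchwartzMap.smulLeftCLM_apply_apply (hasTemperateGrowth_polyE p), smul_eq_mul,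
    hermiteFun, gauss_eq_gaussianSchwartz, polyE]

omit [DecidableEq σ] in
/-- The same through the coordinate map `EuclideanSpace.equiv σ ℝ` (which is the coercion). [folklore] -/
theorem coe_hermiteSchwartz (p : MvPolynomial σ ℂ) :
    ⇑(hermiteSchwartz p) = fun x : EuclideanSpace ℝ σ => hermiteFun p (EuclideanSpace.equiv σ ℝ x) :=
  funext (hermiteSchwartz_apply p)

omit [DecidableEq σ] in
/-- Additivity in the symbol. [folklore] -/
theorem hermiteSchwartz_add (p q : MvPolynomial σ ℂ) :
    hermiteSchwartz (p + q) = hermiteSchwartz p + hermiteSchwartz q := by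
  ext x
  simp [hermiteSchwartz_apply, hermiteFun_add]

omit [DecidableEq σ] in
/-- Homogeneity in the symbol. [folklore] -/
theorem hermiteSchwartz_smul (c : ℂ) (p : MvPolynomial σ ℂ) :
    hermiteSchwartz (c • p) = c • hermiteSchwartz p := by
  ext x
  simp [hermiteSchwartz_apply, hermiteFun_smul]

omit [DecidableEq σ] in
/-- The packaging as a `ℂ`-linear map `ℂ[x_σ] →ₗ 𝓢(EuclideanSpace ℝ σ, ℂ)`. [folklore] -/
def hermiteSchwartzₗ : MvPolynomial σ ℂ →ₗ[ℂ] 𝓢(EuclideanSpace ℝ σ, ℂ) where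
  toFun := hermiteSchwartz
  map_add' := hermiteSchwartz_add
  map_smul' := hermiteSchwartz_smul

omit [DecidableEq σ] in
/-- `hermiteSchwartzₗ p = hermiteSchwartz p`. [folklore] -/
@[simp] theorem hermiteSchwartzₗ_apply (p : MvPolynomial σ ℂ) : hermiteSchwartzₗ p = hermiteSchwartz p := rfl

omit [DecidableEq σ] in
/-- The symbol is determined by the Schwartz function (`FockHermite.hermiteFun_injective`). [folklore] -/
theorem hermiteSchwartz_injective : Function.Injective (hermiteSchwartz (σ := σ)) := by
  intro p q h
  apply hermiteFun_injective
  funext y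
  have := congr_arg (fun f : 𝓢(EuclideanSpace ℝ σ, ℂ) => f ((EuclideanSpace.equiv σ ℝ).symm y)) h
  simpa only [hermiteSchwartz_apply, PiLp.coe_symm_continuousLinearEquiv, WithLp.ofLp_toLp] using this

/-- The matrix of a continuous linear vector field on Euclidean space in the standard coordinates, as a linear
map of `σ → ℝ` (conjugation by `EuclideanSpace.equiv`). [folklore] -/
def toCoords (A : EuclideanSpace ℝ σ →L[ℝ] EuclideanSpace ℝ σ) : (σ → ℝ) →ₗ[ℝ] (σ → ℝ) :=
  ((EuclideanSpace.equiv σ ℝ : EuclideanSpace ℝ σ →L[ℝ] (σ → ℝ)).comp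
    (A.comp ((EuclideanSpace.equiv σ ℝ).symm : (σ → ℝ) →L[ℝ] EuclideanSpace ℝ σ))).toLinearMap

omit [Fintype σ] [DecidableEq σ] in
/-- `toCoords A (⇑x) = ⇑(A x)`. [folklore] -/
theorem toCoords_apply_coe (A : EuclideanSpace ℝ σ →L[ℝ] EuclideanSpace ℝ σ) (x : EuclideanSpace ℝ σ) :
    toCoords A (⇑x : σ → ℝ) = ⇑(A x) := by
  simp [toCoords, PiLp.coe_continuousLinearEquiv, PiLp.coe_symm_continuousLinearEquiv, WithLp.toLp_ofLp]

/-- **The Hermite span in `𝓢(E, ℂ)` is stable under linear vector fields**: for `A : E →L[ℝ] E`,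
`D(hermiteSchwartz p)(x)(A x) = hermiteSchwartz (linSymb (toCoords A) p) x`. [folklore] -/
theorem fderiv_hermiteSchwartz_linear (p : MvPolynomial σ ℂ)
    (A : EuclideanSpace ℝ σ →L[ℝ] EuclideanSpace ℝ σ) (x : EuclideanSpace ℝ σ) :
    fderiv ℝ (⇑(hermiteSchwartz p)) x (A x) = hermiteSchwartz (linSymb (toCoords A) p) x := by
  rw [coe_hermiteSchwartz, hermiteSchwartz_apply]
  have hd : HasFDerivAt (fun y : EuclideanSpace ℝ σ => hermiteFun p (EuclideanSpace.equiv σ ℝ y))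
      ((fderiv ℝ (hermiteFun p) (EuclideanSpace.equiv σ ℝ x)).comp
        (EuclideanSpace.equiv σ ℝ : EuclideanSpace ℝ σ →L[ℝ] (σ → ℝ))) x :=
    ((differentiable_hermiteFun p) _).hasFDerivAt.comp x
      (EuclideanSpace.equiv σ ℝ : EuclideanSpace ℝ σ ≃L[ℝ] (σ → ℝ)).hasFDerivAt
  rw [hd.fderiv, ContinuousLinearMap.comp_apply, ContinuousLinearEquiv.coe_coe, ← fderiv_hermiteFun_linear,
    toCoords_apply_coe]
  rfl

/-- **Along a curve in `E` with linear velocity field** (e.g. `s ↦ e^{sA} x`): if `γ s₀ = x` and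
`γ' (s₀) = A x`, then `d/ds|_{s₀} hermiteSchwartz p (γ s) = hermiteSchwartz (linSymb (toCoords A) p) x` — the
pointwise form of "the Hermite functions are smooth vectors for `f ↦ f ∘ e^{sA}`, with generator of symbol
`linSymb`". [folklore] -/
theorem hasDerivAt_hermiteSchwartz_comp_of_hasDerivAt (p : MvPolynomial σ ℂ)
    (A : EuclideanSpace ℝ σ →L[ℝ] EuclideanSpace ℝ σ) {γ : ℝ → EuclideanSpace ℝ σ}
    {x : EuclideanSpace ℝ σ} {s₀ : ℝ} (hγ : HasDerivAt γ (A x) s₀) (hx : γ s₀ = x) :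
    HasDerivAt (fun s => hermiteSchwartz p (γ s)) (hermiteSchwartz (linSymb (toCoords A) p) x) s₀ := by
  subst hx
  have h := (((hermiteSchwartz p).differentiableAt (x := γ s₀)).hasFDerivAt).comp_hasDerivAt s₀ hγ
  rw [fderiv_hermiteSchwartz_linear] at h
  exact h

end Schwartz

end Literature.Analysis.SegalBargmann

end
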